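import Summits.AnomalousDissipation.AnomalousDissipation.Theorems.ImpulseGridGridInjectionIdentity
import Summits.AnomalousDissipation.AnomalousDissipation.Theorems.ImpulseGridGridThesisStubLaplacianPairingBound
import Summits.AnomalousDissipation.AnomalousDissipation.Theorems.ImpulseGridGridThesisStubWorkSplitTransfer

/-!
# Route ImpulseGrid (AnomalousDissipation) — the grid sign law in first-moment form

Support file for the crux `GridSignsLaw` (item stmt-AnomalousDissipation-14349), line `Sketch`
(card `mean-wake-quadrant`). The crux asks for one grid design `(Φ, Ψ, G, c)` such that every
bounded-energy vanishing-viscosity drift family of global Leray–Hopf solutions forced by `Φ • G`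
eventually satisfies, in one generalized limit `Λ`, (a) `0 ≤ Λ⟨(G,uⱼ)⟩` and
(b) `Λ⟨∫⟪wⱼ,(wⱼ·∇)(Ψ•G)⟫⟩ ≤ −η`, `wⱼ = uⱼ − c e₀`.

We prove that the cubic functional (b) and the sawtooth `Ψ` are eliminable: **`GridSignsLaw` is
equivalent to its FIRST-MOMENT FORM** — same design clauses, same families, and eventually in `j`
the two linear conditions on the mean wake

* DC work non-negative: `0 ≤ Λ⟨(G, uⱼ)⟩`,
* AC work floor: `κ ≤ Λ⟨((Φ − 1) • G, uⱼ)⟩` for some `κ > 0`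

(`gridSignsLaw_iff_firstMomentLaw`). The two directions are `gridSignsLaw_of_firstMomentLaw`
(`η := cκ/2`) and `firstMomentLaw_of_gridSignsLaw` (`κ := η/(2c)`). Both rest on conjunct (1) of
the landed grid injection identity `impulseGrid_gridInjectionIdentity` with the design clause
`∫ΦΨ‖G‖² = 0`, i.e. `Λ⟨∫⟪w,(w·∇)(Ψ•G)⟫⟩ = −c·Λ⟨((Φ−1)•G,u)⟩ − ν·Λ⟨(u,Δ(Ψ•G))⟩`
(`longTimeAvg_inner_sub_one_smul` for the split), and on the ν-uniform Laplacian pairing bound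
`|Λ⟨(u,Δ(Ψ•G))⟩| ≤ ‖Δ(Ψ•G)‖_∞ (1 + meanEnergy u)/2` (`stub_laplacianPairingBound`), which makes
the viscous term `O(νⱼ)` along a family with `meanEnergy uⱼ ≤ E`.

Consequence for the crux chain: the lead skeleton `Lines/Sketch.lean` closes `GridSignsLaw`
modulo the single stub `stub_firstMomentLaw` (the right-hand side of the equivalence), which the
card's C⁺ `MeanWakeMargin` (margins in both floors, for every `Λ`) implies trivially.

No new definitions (the first-moment law is written out in each statement).
-/

noncomputable section

-- `Summit.<Summit>.<Problem>` is the tree's mandated summit-side namespace (CONVENTIONS §2); for this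
-- single-conjunct summit the two coincide, so the duplicate is deliberate.
set_option linter.dupNamespace false

open MeasureTheory Set Filter Topology
open scoped InnerProductSpace RealInnerProductSpace

namespace Summit.AnomalousDissipation.AnomalousDissipation.Theorems

open Literature.Analysis.FluidPDE Literature.Analysis.FluidPDE.Torus
open Literature.Analysis.FunctionSpaces Literature.Analysis.FunctionSpaces.Torus
open Summit.AnomalousDissipation.AnomalousDissipation.Theses.ImpulseGrid

/-- **The viscous remainder is uniformly small along a bounded-energy family.** For the design
fields `Ψ, G` (smooth), a global Leray–Hopf solution `u` with a sup-energy bound and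
`meanEnergy u ≤ E`, and `‖Δ(Ψ•G)‖ ≤ M` pointwise:
`|Λ⟨(u, Δ(Ψ•G))⟩| ≤ M (1 + E)/2` (from `stub_laplacianPairingBound` and monotonicity in the mean
energy, `M ≥ 0`). [folklore] -/
theorem firstMoment_abs_laplacianPairing_le (Λ : GeneralizedLimit) {ν M E : ℝ}
    {Ψ : UnitAddTorus (Fin 3) → ℝ} {G f u₀ : UnitAddTorus (Fin 3) → EuclideanSpace ℝ (Fin 3)}
    {u : ℝ → UnitAddTorus (Fin 3) → EuclideanSpace ℝ (Fin 3)} (hΨ : IsSmooth Ψ) (hG : IsSmooth G)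
    (hM : ∀ x, ‖laplacian (fun y => Ψ y • G y) x‖ ≤ M)
    (hu : IsGlobalLerayHopf ν (fun _ => f) u₀ u)
    (hsup : ∃ C : ℝ, ∀ t : ℝ, 0 ≤ t → kineticEnergy (u t) ≤ C) (hE : meanEnergy u ≤ E) :
    |Λ.longTimeAvg (fun t => ∫ x, ⟪u t x, laplacian (fun y => Ψ y • G y) x⟫)| ≤
      M * (1 + E) / 2 := by
  have hM0 : 0 ≤ M := (norm_nonneg _).trans (hM 0)
  have h := stub_laplacianPairingBound Λ ν M f (fun y => Ψ y • G y) u₀ u (hΨ.smul' hG) hM hu hsup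
  have hmono : M * (1 + meanEnergy u) / 2 ≤ M * (1 + E) / 2 := by
    have : M * (1 + meanEnergy u) ≤ M * (1 + E) := mul_le_mul_of_nonneg_left (by linarith) hM0
    linarith
  exact h.trans hmono

/-- **The (b)-functional in first-moment form.** Along a global Leray–Hopf solution with a
sup-energy bound, for the grid design (`∂₀Ψ = Φ − 1`, `G` transverse, `x₀`-invariant,
divergence free, `∫ΦΨ‖G‖² = 0`):
`Λ⟨∫⟪w,(w·∇)(Ψ•G)⟫⟩ = −c·Λ⟨((Φ−1)•G, u)⟩ − ν·Λ⟨(u, Δ(Ψ•G))⟩`, `w = u − c e₀`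
(conjunct (1) of `impulseGrid_gridInjectionIdentity` and `longTimeAvg_inner_sub_one_smul`). [folklore] -/
theorem firstMoment_bFunctional_eq (Λ : GeneralizedLimit) {ν c : ℝ}
    {Φ Ψ : UnitAddTorus (Fin 3) → ℝ} {G u₀ : UnitAddTorus (Fin 3) → EuclideanSpace ℝ (Fin 3)}
    {u : ℝ → UnitAddTorus (Fin 3) → EuclideanSpace ℝ (Fin 3)} (hν : 0 < ν) (hΦ : IsSmooth Φ)
    (hΨ : IsSmooth Ψ) (hG : IsSmooth G)
    (hΨinv : ∀ (s : UnitAddCircle) x, Ψ (x + Pi.single (1 : Fin 3) s) = Ψ x ∧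
      Ψ (x + Pi.single (2 : Fin 3) s) = Ψ x)
    (hGinv : ∀ (s : UnitAddCircle) x, G (x + Pi.single (0 : Fin 3) s) = G x) (hG0 : ∀ x, G x 0 = 0)
    (hGdiv : IsDivFree G) (hΨderiv : ∀ x, partialDeriv 0 Ψ x = Φ x - 1)
    (hΦΨG : ∫ x, Φ x * Ψ x * ‖G x‖ ^ 2 = 0)
    (hu : IsGlobalLerayHopf ν (fun _ => fun x => Φ x • G x) u₀ u)
    (hsup : ∃ C : ℝ, ∀ t : ℝ, 0 ≤ t → kineticEnergy (u t) ≤ C) :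
    Λ.longTimeAvg (fun t => ∫ x, ⟪u t x - c • EuclideanSpace.single 0 1,
        convect (fun y => u t y - c • EuclideanSpace.single 0 1) (fun y => Ψ y • G y) x⟫) =
      -(c * Λ.longTimeAvg (fun t => ∫ x, ⟪(Φ x - 1) • G x, u t x⟫)) -
        ν * Λ.longTimeAvg (fun t => ∫ x, ⟪u t x, laplacian (fun y => Ψ y • G y) x⟫) := by
  have hid := (impulseGrid_gridInjectionIdentity Λ ν c Φ Ψ G u₀ u hν hΦ hΨ hG hΨinv hGinv hG0
    hGdiv hΨderiv hu hsup).1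
  have hsplit := WorkSplitTransfer.longTimeAvg_inner_sub_one_smul Λ hΦ.continuous hG.continuous hu
  rw [hΦΨG, sub_zero] at hid
  rw [hsplit]
  linarith

/-- **First-moment law ⇒ grid sign law** (the transfer of line `Sketch`, card
`mean-wake-quadrant`). If some grid design makes every bounded-energy drift family satisfy,
eventually in `j` and in one generalized limit `Λ`, `0 ≤ Λ⟨(G,uⱼ)⟩` and `κ ≤ Λ⟨((Φ−1)•G,uⱼ)⟩`
(`κ > 0`), then `GridSignsLaw` holds for the same design with `η := cκ/2`: (a) is the first floor,
and (b) follows from `firstMoment_bFunctional_eq`, the second floor and the ν-uniform bound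
`firstMoment_abs_laplacianPairing_le` once `νⱼ (|M(1+E)/2| + 1) < cκ/2`. [folklore] -/
theorem gridSignsLaw_of_firstMomentLaw
    (h : ∃ (Φ Ψ : UnitAddTorus (Fin 3) → ℝ) (G : UnitAddTorus (Fin 3) → EuclideanSpace ℝ (Fin 3))
      (c : ℝ), (IsSmooth Φ ∧ IsSmooth Ψ ∧ IsSmooth G ∧
        (∀ (s : UnitAddCircle) x, Φ (x + Pi.single (1 : Fin 3) s) = Φ x ∧
          Φ (x + Pi.single (2 : Fin 3) s) = Φ x) ∧
        (∫ x, Φ x = 1) ∧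
        (∀ (s : UnitAddCircle) x, Ψ (x + Pi.single (1 : Fin 3) s) = Ψ x ∧
          Ψ (x + Pi.single (2 : Fin 3) s) = Ψ x) ∧
        (∀ (s : UnitAddCircle) x, G (x + Pi.single (0 : Fin 3) s) = G x) ∧ (∀ x, G x 0 = 0) ∧
        IsDivFree G ∧ (∀ x, partialDeriv 0 Ψ x = Φ x - 1) ∧
        (∫ x, Φ x * Ψ x * ‖G x‖ ^ 2 = 0) ∧
        IsSmooth (fun x => Φ x • G x) ∧ IsDivFree (fun x => Φ x • G x) ∧
        HasZeroMean (fun x => Φ x • G x) ∧ 0 < c) ∧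
      ∀ (ν : ℕ → ℝ) (u₀ : ℕ → UnitAddTorus (Fin 3) → EuclideanSpace ℝ (Fin 3))
        (u : ℕ → ℝ → UnitAddTorus (Fin 3) → EuclideanSpace ℝ (Fin 3)) (E : ℝ),
        (∀ j, 0 < ν j) → Tendsto ν atTop (𝓝 0) →
        (∀ j, IsGlobalLerayHopf (ν j) (fun _ => fun x => Φ x • G x) (u₀ j) (u j)) →
        (∀ j, ∃ C : ℝ, ∀ t : ℝ, 0 ≤ t → kineticEnergy (u j t) ≤ C) →
        (∀ j, ∫ x, u₀ j x = c • EuclideanSpace.single 0 1) →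
        (∀ j, meanEnergy (u j) ≤ E) →
        ∃ κ : ℝ, 0 < κ ∧ ∃ (Λ : GeneralizedLimit) (J : ℕ), ∀ j, J ≤ j →
          0 ≤ Λ.longTimeAvg (fun t => ∫ x, ⟪G x, u j t x⟫) ∧
          κ ≤ Λ.longTimeAvg (fun t => ∫ x, ⟪(Φ x - 1) • G x, u j t x⟫)) :
    GridSignsLaw := by
  obtain ⟨Φ, Ψ, G, c, ⟨hΦ, hΨ, hG, hΦinv, hΦmass, hΨinv, hGinv, hG0, hGdiv, hΨderiv, hΦΨG, hfs,
    hfd, hfm, hc⟩, hlaw⟩ := h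
  refine ⟨Φ, Ψ, G, c, hΦ, hΨ, hG, hΦinv, hΦmass, hΨinv, hGinv, hG0, hGdiv, hΨderiv, hΦΨG, hfs,
    hfd, hfm, hc, ?_⟩
  intro ν u₀ u E hν hν0 hu hsup hdrift hE
  obtain ⟨κ, hκ, Λ, J₁, hJ₁⟩ := hlaw ν u₀ u E hν hν0 hu hsup hdrift hE
  -- the sup norm of `Δ(Ψ • G)` and the uniform size `R` of the viscous remainder
  have hΨG : IsSmooth (fun x => Ψ x • G x) := hΨ.smul' hG
  obtain ⟨M, -, hM⟩ := exists_nonneg_forall_norm_le_of_continuous hΨG.laplacian.continuous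
  set R : ℝ := M * (1 + E) / 2 with hR
  have hR1 : 0 < |R| + 1 := by positivity
  have hδ : 0 < c * κ / (2 * (|R| + 1)) := by positivity
  obtain ⟨J₂, hJ₂⟩ := eventually_atTop.1 ((tendsto_order.1 hν0).2 _ hδ)
  refine ⟨c * κ / 2, by positivity, Λ, max J₁ J₂, fun j hj => ?_⟩
  obtain ⟨ha, hb⟩ := hJ₁ j ((le_max_left _ _).trans hj)
  have hνj : ν j < c * κ / (2 * (|R| + 1)) := hJ₂ j ((le_max_right _ _).trans hj)
  refine ⟨ha, ?_⟩
  have hbeq := firstMoment_bFunctional_eq Λ (c := c) (hν j) hΦ hΨ hG hΨinv hGinv hG0 hGdiv hΨderiv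
    hΦΨG (hu j) (hsup j)
  have hbd := firstMoment_abs_laplacianPairing_le Λ hΨ hG hM (hu j) (hsup j) (hE j)
  set L : ℝ := Λ.longTimeAvg (fun t => ∫ x, ⟪u j t x, laplacian (fun y => Ψ y • G y) x⟫) with hL
  set D : ℝ := Λ.longTimeAvg (fun t => ∫ x, ⟪(Φ x - 1) • G x, u j t x⟫) with hD
  have hLR : -R ≤ L := (abs_le.1 hbd).1
  have hRabs : R ≤ |R| + 1 := (le_abs_self R).trans (le_add_of_nonneg_right zero_le_one)
  have h1 : -(ν j * R) ≤ ν j * L := by nlinarith [hν j]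
  have h2 : ν j * R ≤ ν j * (|R| + 1) := mul_le_mul_of_nonneg_left hRabs (hν j).le
  have h3 : ν j * (|R| + 1) ≤ c * κ / (2 * (|R| + 1)) * (|R| + 1) :=
    mul_le_mul_of_nonneg_right hνj.le hR1.le
  have h4 : c * κ / (2 * (|R| + 1)) * (|R| + 1) = c * κ / 2 := by
    field_simp
  have hcD : c * κ ≤ c * D := mul_le_mul_of_nonneg_left hb hc.le
  rw [hbeq]
  linarith

/-- **Grid sign law ⇒ first-moment law** (converse of the transfer). If `GridSignsLaw` holds,
then for the same design every bounded-energy drift family eventually satisfies `0 ≤ Λ⟨(G,uⱼ)⟩`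
(this is (a)) and `κ ≤ Λ⟨((Φ−1)•G,uⱼ)⟩` with `κ := η/(2c)`: by `firstMoment_bFunctional_eq`,
`c·Λ⟨((Φ−1)•G,uⱼ)⟩ = −Bⱼ − νⱼLⱼ ≥ η − νⱼ|Lⱼ|`, and `νⱼ|Lⱼ| ≤ η/2` eventually by the ν-uniform
bound `firstMoment_abs_laplacianPairing_le`. [folklore] -/
theorem firstMomentLaw_of_gridSignsLaw (h : GridSignsLaw) :
    ∃ (Φ Ψ : UnitAddTorus (Fin 3) → ℝ) (G : UnitAddTorus (Fin 3) → EuclideanSpace ℝ (Fin 3))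
      (c : ℝ), (IsSmooth Φ ∧ IsSmooth Ψ ∧ IsSmooth G ∧
        (∀ (s : UnitAddCircle) x, Φ (x + Pi.single (1 : Fin 3) s) = Φ x ∧
          Φ (x + Pi.single (2 : Fin 3) s) = Φ x) ∧
        (∫ x, Φ x = 1) ∧
        (∀ (s : UnitAddCircle) x, Ψ (x + Pi.single (1 : Fin 3) s) = Ψ x ∧
          Ψ (x + Pi.single (2 : Fin 3) s) = Ψ x) ∧
        (∀ (s : UnitAddCircle) x, G (x + Pi.single (0 : Fin 3) s) = G x) ∧ (∀ x, G x 0 = 0) ∧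
        IsDivFree G ∧ (∀ x, partialDeriv 0 Ψ x = Φ x - 1) ∧
        (∫ x, Φ x * Ψ x * ‖G x‖ ^ 2 = 0) ∧
        IsSmooth (fun x => Φ x • G x) ∧ IsDivFree (fun x => Φ x • G x) ∧
        HasZeroMean (fun x => Φ x • G x) ∧ 0 < c) ∧
      ∀ (ν : ℕ → ℝ) (u₀ : ℕ → UnitAddTorus (Fin 3) → EuclideanSpace ℝ (Fin 3))
        (u : ℕ → ℝ → UnitAddTorus (Fin 3) → EuclideanSpace ℝ (Fin 3)) (E : ℝ),
        (∀ j, 0 < ν j) → Tendsto ν atTop (𝓝 0) →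
        (∀ j, IsGlobalLerayHopf (ν j) (fun _ => fun x => Φ x • G x) (u₀ j) (u j)) →
        (∀ j, ∃ C : ℝ, ∀ t : ℝ, 0 ≤ t → kineticEnergy (u j t) ≤ C) →
        (∀ j, ∫ x, u₀ j x = c • EuclideanSpace.single 0 1) →
        (∀ j, meanEnergy (u j) ≤ E) →
        ∃ κ : ℝ, 0 < κ ∧ ∃ (Λ : GeneralizedLimit) (J : ℕ), ∀ j, J ≤ j →
          0 ≤ Λ.longTimeAvg (fun t => ∫ x, ⟪G x, u j t x⟫) ∧
          κ ≤ Λ.longTimeAvg (fun t => ∫ x, ⟪(Φ x - 1) • G x, u j t x⟫) := by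
  obtain ⟨Φ, Ψ, G, c, hΦ, hΨ, hG, hΦinv, hΦmass, hΨinv, hGinv, hG0, hGdiv, hΨderiv, hΦΨG, hfs,
    hfd, hfm, hc, hlaw⟩ := h
  refine ⟨Φ, Ψ, G, c, ⟨hΦ, hΨ, hG, hΦinv, hΦmass, hΨinv, hGinv, hG0, hGdiv, hΨderiv, hΦΨG, hfs,
    hfd, hfm, hc⟩, ?_⟩
  intro ν u₀ u E hν hν0 hu hsup hdrift hE
  obtain ⟨η, hη, Λ, J₁, hJ₁⟩ := hlaw ν u₀ u E hν hν0 hu hsup hdrift hE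
  have hΨG : IsSmooth (fun x => Ψ x • G x) := hΨ.smul' hG
  obtain ⟨M, -, hM⟩ := exists_nonneg_forall_norm_le_of_continuous hΨG.laplacian.continuous
  set R : ℝ := M * (1 + E) / 2 with hR
  have hR1 : 0 < |R| + 1 := by positivity
  have hδ : 0 < η / (2 * (|R| + 1)) := by positivity
  obtain ⟨J₂, hJ₂⟩ := eventually_atTop.1 ((tendsto_order.1 hν0).2 _ hδ)
  refine ⟨η / (2 * c), by positivity, Λ, max J₁ J₂, fun j hj => ?_⟩
  obtain ⟨ha, hb⟩ := hJ₁ j ((le_max_left _ _).trans hj)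
  have hνj : ν j < η / (2 * (|R| + 1)) := hJ₂ j ((le_max_right _ _).trans hj)
  refine ⟨ha, ?_⟩
  have hbeq := firstMoment_bFunctional_eq Λ (c := c) (hν j) hΦ hΨ hG hΨinv hGinv hG0 hGdiv hΨderiv
    hΦΨG (hu j) (hsup j)
  have hbd := firstMoment_abs_laplacianPairing_le Λ hΨ hG hM (hu j) (hsup j) (hE j)
  set L : ℝ := Λ.longTimeAvg (fun t => ∫ x, ⟪u j t x, laplacian (fun y => Ψ y • G y) x⟫) with hL
  set D : ℝ := Λ.longTimeAvg (fun t => ∫ x, ⟪(Φ x - 1) • G x, u j t x⟫) with hD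
  have hLR : L ≤ R := (abs_le.1 hbd).2
  have hRabs : R ≤ |R| + 1 := (le_abs_self R).trans (le_add_of_nonneg_right zero_le_one)
  have h1 : ν j * L ≤ ν j * R := mul_le_mul_of_nonneg_left hLR (hν j).le
  have h2 : ν j * R ≤ ν j * (|R| + 1) := mul_le_mul_of_nonneg_left hRabs (hν j).le
  have h3 : ν j * (|R| + 1) ≤ η / (2 * (|R| + 1)) * (|R| + 1) :=
    mul_le_mul_of_nonneg_right hνj.le hR1.le
  have h4 : η / (2 * (|R| + 1)) * (|R| + 1) = η / 2 := by
    field_simp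
  -- `c D = -B - ν L ≥ η - η/2`
  rw [hbeq] at hb
  have hcD : η / 2 ≤ c * D := by linarith
  have hκ : η / (2 * c) * c = η / 2 := by field_simp
  have hDge : η / (2 * c) * c ≤ D * c := by nlinarith
  exact le_of_mul_le_mul_right hDge hc

/-- **`GridSignsLaw` in first-moment form (equivalence).** The crux of route ImpulseGrid is
equivalent to: some grid design (the fifteen design clauses of `GridSignsLaw`) such that every
bounded-energy vanishing-viscosity drift family of global Leray–Hopf solutions (the six family
hypotheses of `GridSignsLaw`) admits `κ > 0`, one generalized limit `Λ` and a threshold `J` with,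
for `j ≥ J`, non-negative DC work `0 ≤ Λ⟨(G,uⱼ)⟩` and an AC-work floor `κ ≤ Λ⟨((Φ−1)•G,uⱼ)⟩`.
The cubic Reynolds-stress functional of (b) and the sawtooth `Ψ` enter only through the exact
injection identity and an `O(νⱼ)` viscous remainder. [folklore] -/
theorem gridSignsLaw_iff_firstMomentLaw :
    GridSignsLaw ↔
    ∃ (Φ Ψ : UnitAddTorus (Fin 3) → ℝ) (G : UnitAddTorus (Fin 3) → EuclideanSpace ℝ (Fin 3))
      (c : ℝ), (IsSmooth Φ ∧ IsSmooth Ψ ∧ IsSmooth G ∧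
        (∀ (s : UnitAddCircle) x, Φ (x + Pi.single (1 : Fin 3) s) = Φ x ∧
          Φ (x + Pi.single (2 : Fin 3) s) = Φ x) ∧
        (∫ x, Φ x = 1) ∧
        (∀ (s : UnitAddCircle) x, Ψ (x + Pi.single (1 : Fin 3) s) = Ψ x ∧
          Ψ (x + Pi.single (2 : Fin 3) s) = Ψ x) ∧
        (∀ (s : UnitAddCircle) x, G (x + Pi.single (0 : Fin 3) s) = G x) ∧ (∀ x, G x 0 = 0) ∧
        IsDivFree G ∧ (∀ x, partialDeriv 0 Ψ x = Φ x - 1) ∧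
        (∫ x, Φ x * Ψ x * ‖G x‖ ^ 2 = 0) ∧
        IsSmooth (fun x => Φ x • G x) ∧ IsDivFree (fun x => Φ x • G x) ∧
        HasZeroMean (fun x => Φ x • G x) ∧ 0 < c) ∧
      ∀ (ν : ℕ → ℝ) (u₀ : ℕ → UnitAddTorus (Fin 3) → EuclideanSpace ℝ (Fin 3))
        (u : ℕ → ℝ → UnitAddTorus (Fin 3) → EuclideanSpace ℝ (Fin 3)) (E : ℝ),
        (∀ j, 0 < ν j) → Tendsto ν atTop (𝓝 0) →
        (∀ j, IsGlobalLerayHopf (ν j) (fun _ => fun x => Φ x • G x) (u₀ j) (u j)) →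
        (∀ j, ∃ C : ℝ, ∀ t : ℝ, 0 ≤ t → kineticEnergy (u j t) ≤ C) →
        (∀ j, ∫ x, u₀ j x = c • EuclideanSpace.single 0 1) →
        (∀ j, meanEnergy (u j) ≤ E) →
        ∃ κ : ℝ, 0 < κ ∧ ∃ (Λ : GeneralizedLimit) (J : ℕ), ∀ j, J ≤ j →
          0 ≤ Λ.longTimeAvg (fun t => ∫ x, ⟪G x, u j t x⟫) ∧
          κ ≤ Λ.longTimeAvg (fun t => ∫ x, ⟪(Φ x - 1) • G x, u j t x⟫) :=
  ⟨firstMomentLaw_of_gridSignsLaw, gridSignsLaw_of_firstMomentLaw⟩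

end Summit.AnomalousDissipation.AnomalousDissipation.Theorems

end
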